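import Summits.Ventures.CertifiedManyBodySolver.Theorems.M3x2EdgeSplitSymReplayGramRSoundA
import HarnessLib

/-!
# SymReplay gramR — (f) `symCheckR_sound`, `energyDensity_ge_symValueR`, toy end to end (module 3/4)
Text: hub-lb-sym-plan-1 g2 (`Cruxes/LowerEdge_ge_m83o100/SymReplayGramR_symplan1.lean` rev 3, a26d6b87249c), landed verbatim by hub-lb-sym-eng-3. No summit or crux statement is proved here; no certificate beyond toys is replayed; nothing here predicts superconductivity.
-/

noncomputable section

namespace Summit.Ventures.CertifiedManyBodySolver.Theorems.SymReplay

open Matrix Finset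
open Literature.MathematicalPhysics.QuantumLattice
open Literature.MathematicalPhysics.QuantumLattice.HubbardWave0
open Literature.MathematicalPhysics.QuantumLattice.ThermodynamicLimit
open Literature.Probability.LatticeModels
open Literature.MathematicalPhysics.QuantumManyBody.StateRelaxation
open Summit.Ventures.CertifiedManyBodySolver.Theorems.WardSlot
open scoped ComplexOrder BigOperators

/-! #### (f) Soundness of the R-checker -/

/-- Negated use (`z ↦ −z`). -/
def negUse (e : IdUse) : IdUse := ⟨-e.z, e.u, e.γ, e.v⟩

/-- Helper `useOp_negUse`. -/
theorem useOp_negUse (Λ' : Finset (Site 2)) (e : IdUse) : useOp Λ' (negUse e) = -useOp Λ' e := by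
  simp only [useOp, negUse, Rat.cast_neg, neg_smul]

/-- The canonicaliser's uses on the R-residual. -/
def canonUsesR (K : SymCertR) : List IdUse :=
  if K.useCanon then (residualR K).flatMap (usesOfTerm (flatSite (minCorner K.frame)) K.frame) else []

/-- The identification family DERIVED (never shipped) for an R-certificate: the canonicaliser's uses, then the
negated block uses of every R-block. -/
def usesR (K : SymCertR) : List IdUse := canonUsesR K ++ (K.gramR.flatMap blockUses).map negUse

/-- The residual equation for a general polynomial `P` passing the (canonicalised) zero test:
`polyOp Λ' P = Σ (canonicaliser's uses)` (T9's `residual_expansion` with `psub lhs rhs` generalised to `P`). -/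
theorem residual_expansion_poly (h1 : NfFaithful) {Λ' : Finset (Site 2)} (corner : Site 2) (frame : List (Site 2))
    (useCanon : Bool) (P : QPoly) (hfr : frame.toFinset ⊆ Λ') (hsupp : PSupp P Λ')
    (hid : isZero (if useCanon then (collect (nfPoly P)).flatMap (canonTermA corner frame)
      else collect (nfPoly P)) = true) :
    polyOp Λ' P = ((if useCanon then (collect (nfPoly P)).flatMap (usesOfTerm corner frame) else []).map
      (useOp Λ')).sum := by
  have hres : polyOp Λ' (collect (nfPoly P)) = polyOp Λ' P := by
    rw [polyOp_eq_evalP, collect_eval, ← polyOp_eq_evalP, polyOp_nfPoly h1 _ _ hsupp]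
  rw [← hres]
  cases useCanon
  · simp only [Bool.false_eq_true, if_false] at hid ⊢
    rw [List.map_nil, List.sum_nil]
    exact polyOp_eq_zero_of_isZero Λ' _ hid
  · simp only [if_true] at hid ⊢
    rw [← sum_canonTerm h1 _ _ hfr (collect (nfPoly P)), polyOp_eq_zero_of_isZero Λ' _ hid, sub_zero]

/-- `rhsPoly` of the expansion = `rhsPolyR` + the block uses (operator level, in any `Λ'` where the R-blocks'
representatives generate and their generated bases pass the eigen-check). -/
theorem polyOp_rhsPoly_expand (Λ' : Finset (Site 2)) (K : SymCertR)
    (hB : ∀ B ∈ K.gramR, (∀ s ∈ B.reps, PSupp (genPre B.moves s) Λ') ∧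
      ∀ q ∈ genBasis B, ∀ m ∈ B.moves, PSupp (movePolyF m.γ m.v q) Λ' ∧
        isZero (psub (nfPoly (movePolyF m.γ m.v q)) (pscale m.χ q)) = true) :
    polyOp Λ' (rhsPoly K.expand) =
      polyOp Λ' (rhsPolyR K) + ((K.gramR.flatMap blockUses).map (useOp Λ')).sum := by
  have hX : polyOp Λ' ((K.gramR.map toGramBlock).flatMap gramBlockPoly) =
      polyOp Λ' (K.gramR.flatMap fun B => pscale (B.moves.length : ℚ) (gramBlockPolyR B)) +
        ((K.gramR.flatMap blockUses).map (useOp Λ')).sum := by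
    rw [List.flatMap_map, polyOp_flatMap, polyOp_flatMap, list_sum_map_flatMap, ← List.sum_map_add]
    congr 1
    exact List.map_congr_left fun B hBm => polyOp_toGramBlock Λ' B (hB B hBm).1 (hB B hBm).2
  simp only [rhsPoly, rhsPolyR, SymCertR.expand, List.flatMap_append, polyOp_append, hX]
  abel

/-- Every term of `rhsPoly K.toSymCert` is a term of `rhsPoly K.expand`. -/
theorem rhsPoly_subset_expand (K : SymCertR) : ∀ t ∈ rhsPoly K.toSymCert, t ∈ rhsPoly K.expand := by
  intro t ht
  simp only [rhsPoly, SymCertR.expand, List.mem_append, List.flatMap_append] at ht ⊢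
  tauto

/-- From `gramBlockROK`: lengths, supports of representatives / generators, and the eigen-checks. -/
theorem gramBlockROK_spec {frame : List (Site 2)} {B : GramBlockR} (h : gramBlockROK frame B = true) :
    (∀ s ∈ B.reps, PSupp s frame.toFinset ∧ PSupp (genPre B.moves s) frame.toFinset) ∧
    ∀ q ∈ genBasis B, ∀ m ∈ B.moves, PSupp (movePolyF m.γ m.v q) frame.toFinset ∧
      isZero (psub (nfPoly (movePolyF m.γ m.v q)) (pscale m.χ q)) = true := by
  simp only [gramBlockROK, Bool.and_eq_true, List.all_eq_true] at h
  obtain ⟨⟨-, hs⟩, hq⟩ := h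
  exact ⟨fun s hs' => ⟨PSupp_of_psuppIn (hs s hs').1, PSupp_of_psuppIn (hs s hs').2⟩,
    fun q hq' => eigenOK_spec (hq q hq')⟩

/-- **THE R-CHECKER IS SOUND**: every `SymCertR` passing `symCheckR` is a Ward × affine-`D₄` window certificate of
value `symValueR K`.  Witness = T10's witness for the EXPANSION `K.expand` (whose Gram multiplier contains the full
orbit-generated blocks, PSD by `gramMat_posSemidef`), identification family `usesR K` (derived, not shipped). -/
theorem symCheckR_sound (K : SymCertR) (hK : symCheckR K = true) : WardD4CertGe ((symValueR K : ℚ) : ℝ) := by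
  -- (0) unpack
  have hK' := hK
  simp only [symCheckR, Bool.and_eq_true] at hK'
  obtain ⟨⟨hwf, hRok⟩, hid⟩ := hK'
  have hRok' : ∀ B ∈ K.gramR, gramBlockROK K.frame B = true := List.all_eq_true.1 hRok
  -- (1) well-formedness clauses of the expansion needed for supports
  have hwf' := hwf
  simp only [wellFormed, Bool.and_eq_true] at hwf'
  obtain ⟨⟨⟨⟨⟨⟨⟨⟨⟨⟨⟨⟨⟨hnd, hz0⟩, hn0⟩, hIF⟩, hth⟩, hgram⟩, hgM⟩, heom⟩, hmov⟩, hch⟩, hwp⟩, hwm⟩, hah⟩, hsl⟩ :=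
    hwf'
  have hmov' : ∀ mv ∈ K.expand.moves, suppIn mv.u K.expand.frame = true ∧
      suppIn (moveWordF mv.γ mv.v mv.u) K.expand.frame = true := fun mv hmv => by
    have h := List.all_eq_true.1 hmov mv hmv
    rwa [Bool.and_eq_true] at h
  have h0F : thicken ({0} : Finset (Site 2)) 1 ⊆ K.expand.frame.toFinset := by
    have h : subSites (thick [0]) K.expand.frame = true := by simpa [thick] using hn0
    have h' := thicken_subset_of_thick h
    simpa using h'
  have hsRx : PSupp (rhsPoly K.expand) K.frame.toFinset :=
    PSupp_rhsPoly K.expand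
      (fun g hg => by
        have h := List.all_eq_true.1 hgram g hg
        rw [Bool.and_eq_true, decide_eq_true_eq] at h
        exact h.2)
      (fun B hB => by
        have h := List.all_eq_true.1 hgM B hB
        simp only [gramBlockOK, Bool.and_eq_true, decide_eq_true_eq, List.all_eq_true] at h
        exact h.2)
      (fun B hB => List.all_eq_true.1 heom B hB) hIF hmov'
      (fun t ht => by
        have h := List.all_eq_true.1 hch t ht
        rw [Bool.and_eq_true] at h
        exact h.1)
      (fun X hX => List.all_eq_true.1 hwp X hX) (fun X hX => List.all_eq_true.1 hwm X hX)
      (fun t ht => List.all_eq_true.1 hah t ht) (fun t ht => List.all_eq_true.1 hsl t ht)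
  have hsRb : PSupp (rhsPoly K.toSymCert) K.frame.toFinset := fun t ht => hsRx t (rhsPoly_subset_expand K t ht)
  have hsD : ∀ B ∈ K.gramR, PSupp (gramBlockPolyR B) K.frame.toFinset := fun B hB =>
    PSupp_gramBlockPolyR B (fun s hs => ((gramBlockROK_spec (hRok' B hB)).1 s hs).1)
      (fun q hq => by
        rw [genBasis, List.mem_map] at hq
        obtain ⟨s, hs, rfl⟩ := hq
        exact PSupp_genOne ((gramBlockROK_spec (hRok' B hB)).1 s hs).2)
  have hsRR : PSupp (rhsPolyR K) K.frame.toFinset :=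
    hsRb.append (PSupp.flatMap _ _ fun B hB => (hsD B hB).pscale _)
  have hsL : PSupp (lhsPoly K.toSymCert) K.frame.toFinset := PSupp_lhsPoly K.toSymCert h0F
  have hP : PSupp (psub (lhsPoly K.toSymCert) (rhsPolyR K)) K.frame.toFinset := hsL.psub hsRR
  -- (2) the derived identification family lies on frame words
  have hU : ∀ e ∈ usesR K, SuppIn e.u K.expand.frame.toFinset := by
    intro e he
    rw [usesR, List.mem_append] at he
    rcases he with he | he
    · rw [canonUsesR] at he
      split_ifs at he with hc
      · rw [List.mem_flatMap] at he
        obtain ⟨t, ht, he⟩ := he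
        rw [(usesOfTerm_spec e he).1]
        exact hP.nfPoly.collect t ht
      · simp at he
    · rw [List.mem_map] at he
      obtain ⟨e', he', rfl⟩ := he
      rw [List.mem_flatMap] at he'
      obtain ⟨B, hB, he'⟩ := he'
      rw [blockUses, List.mem_flatMap] at he'
      obtain ⟨m, -, he'⟩ := he'
      obtain ⟨t, ht, hu⟩ := polyUses_u he'
      show SuppIn e'.u K.frame.toFinset
      rw [hu]
      exact hsD B hB t ht
  -- (3) the residual equation in the enlarged frame `Λ″`
  have hL : (envelope K.expand (usesR K)).toList.toFinset = envelope K.expand (usesR K) := Finset.toList_toFinset _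
  have hFL : K.frame.toFinset ⊆ (envelope K.expand (usesR K)).toList.toFinset := by
    rw [hL]; exact (subset_thicken _ 1).trans (thicken_subset_envelope K.expand (usesR K))
  have hBL : ∀ B ∈ K.gramR, (∀ s ∈ B.reps, PSupp (genPre B.moves s) (envelope K.expand (usesR K)).toList.toFinset) ∧
      ∀ q ∈ genBasis B, ∀ m ∈ B.moves,
        PSupp (movePolyF m.γ m.v q) (envelope K.expand (usesR K)).toList.toFinset ∧
          isZero (psub (nfPoly (movePolyF m.γ m.v q)) (pscale m.χ q)) = true := fun B hB =>
    ⟨fun s hs => (((gramBlockROK_spec (hRok' B hB)).1 s hs).2).mono hFL,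
      fun q hq m hm => ⟨((gramBlockROK_spec (hRok' B hB)).2 q hq m hm).1.mono hFL,
        ((gramBlockROK_spec (hRok' B hB)).2 q hq m hm).2⟩⟩
  have hid' : isZero (if K.useCanon then (collect (nfPoly (psub (lhsPoly K.toSymCert) (rhsPolyR K)))).flatMap
      (canonTermA (flatSite (minCorner K.frame)) K.frame)
      else collect (nfPoly (psub (lhsPoly K.toSymCert) (rhsPolyR K)))) = true := hid
  have h1 := residual_expansion_poly stub_nfFaithful (flatSite (minCorner K.frame)) K.frame K.useCanon
    (psub (lhsPoly K.toSymCert) (rhsPolyR K)) hFL (hP.mono hFL) hid'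
  rw [polyOp_psub] at h1
  have h2 := polyOp_rhsPoly_expand (envelope K.expand (usesR K)).toList.toFinset K hBL
  have hR : polyOp (envelope K.expand (usesR K)).toList.toFinset (lhsPoly K.expand) -
      polyOp (envelope K.expand (usesR K)).toList.toFinset (rhsPoly K.expand) =
      ((usesR K).map (useOp (envelope K.expand (usesR K)).toList.toFinset)).sum := by
    have hl : lhsPoly K.expand = lhsPoly K.toSymCert := rfl
    have hsum : ∀ Λ' : Finset (Site 2), ((usesR K).map (useOp Λ')).sum =
        ((canonUsesR K).map (useOp Λ')).sum - ((K.gramR.flatMap blockUses).map (useOp Λ')).sum := fun Λ' => by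
      rw [usesR, List.map_append, List.sum_append, List.map_map, sub_eq_add_neg, ← list_sum_map_neg]
      simp only [Function.comp_def, useOp_negUse]
    have h1' : polyOp (envelope K.expand (usesR K)).toList.toFinset (lhsPoly K.toSymCert) -
        polyOp (envelope K.expand (usesR K)).toList.toFinset (rhsPolyR K) =
        ((canonUsesR K).map (useOp (envelope K.expand (usesR K)).toList.toFinset)).sum := by
      rw [canonUsesR, residualR]; exact h1
    rw [hl, h2, hsum, ← h1']
    abel
  -- (4) S4 in expansion form (T12a `wardD4CertGe_of_expansion`, hub-lb-sym-eng-3) with the family `usesR K`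
  exact wardD4CertGe_of_expansion K.expand hwf (usesR K) hU (eq_add_of_sub_eq' hR)

/-- **UNCONDITIONAL: every R-certificate passing `symCheckR` bounds `e₀(t=1, t'=0, U=8, n=7/8)` from below by its
value** (S6 = `WardSlot.stub_wardWindowSound`).  Axioms `propext / Classical.choice / Quot.sound`. -/
theorem energyDensity_ge_symValueR (K : SymCertR) (hK : symCheckR K = true) :
    ((symValueR K : ℚ) : ℝ) ≤ energyDensityTT' 1 0 8 (7 / 8) :=
  energyDensity_ge_of_windowSound_cert _ WardSlot.stub_wardWindowSound (symCheckR_sound K hK)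

/-- **The first ORBIT-REPRESENTATIVE certificate replayed end to end, NO hypothesis**: `toyRCert` (two R-blocks
`s_σ = c_{0σ} − c_{e₁σ}` under the trivial irrep of `D₄` about `0`, kernel-checked by `decide +kernel`) gives
`−11/4 ≤ e₀(8, 7/8, 0)` (value-wise trivial; the point is that the R-path is kernel-closed on a toy). -/
theorem toyRCert_energy_ge : (((-11) / 4 : ℚ) : ℝ) ≤ energyDensityTT' 1 0 8 (7 / 8) := by
  have h := energyDensity_ge_symValueR toyRCert toyRCert_check
  rwa [toyRCert_value] at h

end Summit.Ventures.CertifiedManyBodySolver.Theorems.SymReplay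

end
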